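import Summits.Ventures.CertifiedManyBodySolver.Rows.DopedTLCorr
import Summits.Ventures.CertifiedManyBodySolver.Observables.StiffnessThermalOddMomentReaderAdapters
import Literature.MathematicalPhysics.QuantumLattice.TorusSectorGibbsMixture
import HarnessLib

/-!
# Ventures/CertifiedManyBodySolver — Rows/DopedTLCorrThermal.lean: the THERMAL twin of the torus-limit correlator row —
# what every `T = 0` window certificate proves about the canonical Gibbs states at ITS OWN point, at every temperature

HONEST FRAMING: a ROW SHAPE (one definition) and its kernel readers; conditional-by-name bookkeeping for CLAIM NODES; no certificate, no
number, no phase sentence. The warrant is `Literature/…/HubbardTTPrimeWindowCertificateThermal` (p644371): the certificate identity of a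
`T = 0` window certificate read in a torus limit of the canonical sector Gibbs states at `(β; 1, t′, U, n)` gives the ground-state conclusion
MINUS the entropy re-pricing `κ·2H_b(n/2)/β` of its energy-cap row (`κ` = the cap multiplier printed in the certificate; `2H_b(1/2) = log 4`).

Cell `pub/hubbard-downfold` × `pub/hubbard-obs` (D-0096 (2) «T > 0» leg), seat `hubbard-downfold-unc-2` (`prover-hubbard-downfold-unc-2-g18-0`).

* §1 `SquareTTPrimeCorrThermalOrbitLowerRow tp U n u r κ S Λ X` — for EVERY `β > 0` and every torus limit `ω` of the canonical
  `(rectN n L, S^z = 0)`-sector Gibbs states of `hubbardTorusTT' L 1 tp U` at `β` (any tori), GIVEN the cap `e(1, tp, U, n) ≤ u`: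
  `r − κ·2H_b(n/2)/β ≤ |S|⁻¹ Σ_{γ∈S} Re ω_{γΛ}(Γ(d4Emb γ 0) X)`. The literals `(u, r)` are those of the ground-state node
  `SquareTTPrimeCorrOrbitLowerRow tp U n u r S Λ X` of the SAME certificate, `κ` its cap multiplier: a typist states the thermal node next to the
  ground-state node from the same bytes (template §3); the referee's replay is unchanged plus reading `κ`.
* §2 READERS: the thermal stiffness leaf `ObsThermalStiffnessSeqCeilingAtBeta tp U n β c` for every `β > 0` and every
  `c ≥ −r + κ·2H_b(n/2)/β` from a thermal row of the f-sum / odd-moment word `−X_λ(tp, U)` (`…_of_thermalOrbitLowerRow`), with the cap discharged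
  by name; monotonicity in the slots.
* §3 TEMPLATE (La214-E hub numbers as an EXAMPLE of the arithmetic only, NOT a node): with `r = −0.3870869`, `κ = 0.2454183`, `n = 1`:
  `ρ_s(T) ≤ 0.3870869 + 0.2454183·log 4/β` at `(−3/10, 29/5, 1)` itself — `≤` the M2(b) bar `0.4364687` for every `β ≥ 7`
  (`T ≤ t/7 ≈ 560–660 K`), where the apex-transport route (`StiffnessApexTransportThermalFromGround`) cannot reach the station at all; doped
  boxes (Hg-1201 corner `κ = 0.0973`, `n = 22/25`: price `0.1336/β`) alike — the decision to TYPE thermal nodes is the pen's.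

References: J. Wang et al., PRX 14 (2024) 031006, §III [WangEtAl2024]; D. Ruelle, *Statistical Mechanics* (1969) §2.5 [Ruelle1969];
D. J. Scalapino, S. R. White, S.-C. Zhang, PRB 47 (1993) 7995, §II [ScalapinoWhiteZhang1993].
-/

noncomputable section

namespace Summit.Ventures.CertifiedManyBodySolver

open Literature.MathematicalPhysics.QuantumLattice
open Literature.MathematicalPhysics.QuantumLattice.InfVolFermionState
open Matrix HubbardWave0 Literature.Probability.LatticeModels ThermodynamicLimit Filter Topology
open Summit.Ventures.CertifiedManyBodySolver.Observables
open scoped BigOperators ComplexOrder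

/-! ## §1 The thermal row shape -/

/-- **THERMAL ORBIT-LOWER ROW** `SquareTTPrimeCorrThermalOrbitLowerRow tp U n u r κ S Λ X`: square lattice, `t = 1`, point `(t′, U) = (tp, U)`,
density `n`; cap literal `u`, value `r`, cap multiplier `κ` (all ℚ, from ONE `T = 0` window certificate). For EVERY `β > 0` and every torus
limit `ω` of the canonical `(rectN n L, S^z = 0)`-sector Gibbs states of `hubbardTorusTT' L 1 tp U` at inverse temperature `β` (any `Ls → ∞`),
GIVEN `e(1, tp, U, n) ≤ u`: `r − κ·2H_b(n/2)/β ≤ |S|⁻¹ Σ_{γ ∈ S} Re ω_{γΛ}(Γ(d4Emb γ 0 Λ) X)`. Warrant: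
`IsTorusLimitOfMixture.re_sum_expect_d4_ge_of_window_certificate_TT'_ineq_of_sectorGibbs_thermal`. [cite: WangEtAl2024, §III] -/
def SquareTTPrimeCorrThermalOrbitLowerRow (tp U n : ℝ) (u r κ : ℚ) (S : Finset (DihedralGroup 4))
    (Λ : Finset (Site 2)) (X : FermionOp Λ) : Prop :=
  ∀ (β : ℝ), 0 < β → ∀ (ω : InfVolFermionState 2) (Ls : ℕ → ℕ), Tendsto Ls atTop atTop →
    ω.IsTorusLimitOfMixture (sectorGibbsCount n) (fun L => sectorGibbsWeightTT' β 1 tp U n L)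
      (fun L => sectorGibbsVectorTT' 1 tp U n L) Ls →
    energyDensityTT' 1 tp U n ≤ ((u : ℚ) : ℝ) →
    ((r : ℚ) : ℝ) - ((κ : ℚ) : ℝ) * (2 * Real.binEntropy (n / 2) / β) ≤
      (S.card : ℝ)⁻¹ * ∑ g ∈ S, (ω.expect (d4ShiftSet g 0 Λ) (fermionEmbed (PolySite.d4Emb g 0 Λ) X)).re

/-! ## §2 Edges and readers -/

section Readers

variable {tp U n : ℝ} {u r κ : ℚ} {S : Finset (DihedralGroup 4)} {Λ : Finset (Site 2)} {X : FermionOp Λ}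

/-- Slot monotonicity: a SMALLER value `r' ≤ r` and a LARGER multiplier `κ' ≥ κ` (with `0 ≤ n ≤ 2`) keep the row. [folklore] -/
theorem SquareTTPrimeCorrThermalOrbitLowerRow.mono (h : SquareTTPrimeCorrThermalOrbitLowerRow tp U n u r κ S Λ X)
    (hn0 : 0 ≤ n) (hn2 : n ≤ 2) {r' κ' : ℚ} (hr : r' ≤ r) (hκ : κ ≤ κ') :
    SquareTTPrimeCorrThermalOrbitLowerRow tp U n u r' κ' S Λ X := by
  intro β hβ ω Ls hLs hω hu
  have hh := h β hβ ω Ls hLs hω hu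
  have hr' : ((r' : ℚ) : ℝ) ≤ ((r : ℚ) : ℝ) := by exact_mod_cast hr
  have hκ' : ((κ : ℚ) : ℝ) ≤ ((κ' : ℚ) : ℝ) := by exact_mod_cast hκ
  have hent : 0 ≤ 2 * Real.binEntropy (n / 2) / β :=
    div_nonneg (mul_nonneg (by norm_num) (Real.binEntropy_nonneg (by linarith) (by linarith))) hβ.le
  nlinarith [mul_le_mul_of_nonneg_right hκ' hent]

/-- A TIGHTER cap premise `u' ≤ u` keeps the row (fewer states qualify). [folklore] -/
theorem SquareTTPrimeCorrThermalOrbitLowerRow.mono_cap (h : SquareTTPrimeCorrThermalOrbitLowerRow tp U n u r κ S Λ X)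
    {u' : ℚ} (hu : u' ≤ u) : SquareTTPrimeCorrThermalOrbitLowerRow tp U n u' r κ S Λ X :=
  fun β hβ ω Ls hLs hω hu' => h β hβ ω Ls hLs hω (hu'.trans (by exact_mod_cast hu))

/-- **THERMAL ROW ⇒ THERMAL STIFFNESS LEAF AT EVERY TEMPERATURE.** A thermal orbit-lower row for the negated f-sum / odd-moment word
`−X_λ(tp, U)` on `box 2 7` (nonempty label set `S`, `0 ≤ n ≤ 2`) with its cap `e(1, tp, U, n) ≤ u` certified gives, for every `β > 0`,
`ObsThermalStiffnessSeqCeilingAtBeta tp U n β c` for every `c ≥ −r + κ·2H_b(n/2)/β` (the tree's thermal odd-moment reader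
`ObsThermalStiffnessSeqCeilingAtBeta_of_torusLimit_neg_oddMomentObs_orbitMean_ge`). [cite: ScalapinoWhiteZhang1993, §II] [cite: WangEtAl2024, §III] -/
theorem ObsThermalStiffnessSeqCeilingAtBeta_of_thermalOrbitLowerRow (lam : ℝ) (hS : S.Nonempty) (hn0 : 0 ≤ n) (hn2 : n ≤ 2)
    (hrow : SquareTTPrimeCorrThermalOrbitLowerRow tp U n u r κ S (box 2 7) (-oddMomentObsTT tp U lam))
    (hu : energyDensityTT' 1 tp U n ≤ ((u : ℚ) : ℝ)) {β : ℝ} (hβ : 0 < β) (c : ℚ)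
    (hc : -((r : ℚ) : ℝ) + ((κ : ℚ) : ℝ) * (2 * Real.binEntropy (n / 2) / β) ≤ ((c : ℚ) : ℝ)) :
    ObsThermalStiffnessSeqCeilingAtBeta tp U n β c := by
  refine ObsThermalStiffnessSeqCeilingAtBeta_of_torusLimit_neg_oddMomentObs_orbitMean_ge hβ hn0 hn2 lam hS (q := c)
    fun ω Ls hLs hω => ?_
  have h := hrow β hβ ω Ls hLs hω hu
  have hcard : (0 : ℝ) < S.card := Nat.cast_pos.2 (Finset.card_pos.2 hS)
  rw [div_eq_inv_mul]
  linarith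

/-- **The `λ = 0` f-sum case with the ground-state reading side by side**: a ground-state row `r₀ ≤ orbit mean` (cap `u`) and its thermal twin with the same
literals and multiplier `κ` give `ObsStiffnessSeqCeilingAt tp U n c₀` for `c₀ ≥ −r` AND `ObsThermalStiffnessSeqCeilingAtBeta tp U n β c` for
`c ≥ −r + κ·2H_b(n/2)/β`, `β > 0` — the `T = 0` word and its `T > 0` continuation at the same point. [cite: ScalapinoWhiteZhang1993, §II] -/
theorem stiffness_groundState_and_thermal_of_rows (hn0 : 0 ≤ n) (hn2 : n < 2)
    (hrow₀ : SquareTTPrimeCorrOrbitLowerRow tp U n u r Finset.univ (box 2 7) (-oddMomentObsTT tp U 0))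
    (hrowT : SquareTTPrimeCorrThermalOrbitLowerRow tp U n u r κ Finset.univ (box 2 7) (-oddMomentObsTT tp U 0))
    (hu : energyDensityTT' 1 tp U n ≤ ((u : ℚ) : ℝ)) (c₀ : ℚ) (hc₀ : -r ≤ c₀) {β : ℝ} (hβ : 0 < β) (c : ℚ)
    (hc : -((r : ℚ) : ℝ) + ((κ : ℚ) : ℝ) * (2 * Real.binEntropy (n / 2) / β) ≤ ((c : ℚ) : ℝ)) :
    ObsStiffnessSeqCeilingAt tp U n c₀ ∧ ObsThermalStiffnessSeqCeilingAtBeta tp U n β c :=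
  ⟨ObsStiffnessSeqCeilingAt_of_oddMomentTT_orbitLowerRow_univ tp U n 0 hn0 hn2.le hrow₀ hu c₀ hc₀,
   ObsThermalStiffnessSeqCeilingAtBeta_of_thermalOrbitLowerRow 0 Finset.univ_nonempty hn0 hn2.le hrowT hu hβ c hc⟩

end Readers

/-! ## §3 Arithmetic of the template (numbers only; NOT a node) -/

/-- **Template arithmetic (La214-E hub literals as an example).** With the hub's printed value `r = −3870869/10⁷`, cap multiplier
`κ = 2454183/10⁷` and `n = 1` (`2H_b(1/2) ≤ 1.3863`): the thermal word `−r + κ·1.3863/β` is below the M2(b) bar `0.4364687` at `β = 7`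
and below the box kinematic word `0.4453763` at `β = 6`; the Hg-1201 corner example (`r = −4950122/10⁷`, `κ = 973/10⁴`, `2H_b(0.44) ≤ 1.3719`):
below its bar `0.5084577` at `β = 10`. [folklore] -/
theorem thermalRow_template_literals :
    ((3870869 / 10000000 : ℚ) + 2454183 / 10000000 * (13863 / 10000) / 7 < 4364687 / 10000000) ∧
    ((3870869 / 10000000 : ℚ) + 2454183 / 10000000 * (13863 / 10000) / 6 < 4453763 / 10000000) ∧
    ((4950122 / 10000000 : ℚ) + 973 / 10000 * (13719 / 10000) / 10 < 5084577 / 10000000) := by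
  norm_num

end Summit.Ventures.CertifiedManyBodySolver

end
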